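import Literature.NumberTheory.AdelicBaseChange.CompletionBaseChange
import Literature.NumberTheory.GaloisRepresentations.KummerGalFixing
import Literature.NumberTheory.EllipticCurves.GreenbergSelmer
import Mathlib.NumberTheory.NumberField.Basic
import HarnessLib

/-!
# Crux `PrintCf2.SplitBadTwoRankOneOfFacts` (stmt-BirchSwinnertonDyer-20368), S3n′-FACT-FREE road, R2 brick B4c (= (P) of -w5 g7's
# `R2-BRICKS` §3): LOCAL POWERS AT THE PLACES ABOVE `v`, FROM `Γ_K`-INTERNAL TO COMPLETION CURRENCY —
# a root `β ∈ K̄` of `βⁿ = x ∈ F` fixed by `Gal(K̄/F) ∩ σ⁻¹ D_v σ` for every `σ ∈ Γ_K` makes `x` an `n`-th power in EVERY completion `F_w`, `w ∣ v`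

Cell `bsd-print-cf2`, EXTRA WIDTH seat `bsd-line-cf2-p1-w3` g13 (prover-bsd-line-cf2-p1-w3-g13-0); `--supports stmt-BirchSwinnertonDyer-20368`
(helper, Theses-free). HONEST FRAMING: nothing here closes the crux or a registered stub; BSD is not proved by any of this; no summit
statement is proved by this seat. No definition, no named fact, no `sorry`. UNCONDITIONAL; generic number field `K`, finite `F ⊆ K̄`, any
finite place `v`, any exponent `n`.

WHY (memos `Cruxes/SplitBadTwoRankOneOfFacts/S3N-FACTFREE-w2g14.md` §3/§7 and `R2-BRICKS` (-w5 g7) §3 B4c). The arithmetic input of the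
level lift, R1 = -w2 g14 `KummerProNull.exists_level_forall_exists_pow_eq_of_local` (p696581), wants its hypothesis at the places above `v`
in COMPLETION currency: `∀ w : v.Extension (𝓞 F), ∃ y : w.1.adicCompletion F, y ^ p ^ M = x`. The Shapiro/Mackey reading of the dual
Selmer condition «strict above `v`» (B2b) delivers it in `Γ_K`-INTERNAL currency: the Kummer class of `x` — the class of `τ ↦ τβ/β`,
`βⁿ = x` — dies on `U ∩ σ⁻¹ D_v σ` for every `σ ∈ Γ_K` (`U = Gal(K̄/F) = galFixing K F`, `D_v = decomp v` the decomposition group of the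
tree's chosen embedding `ι_v : K̄ → K̄_v`), i.e. (after absorbing the coboundary into `β`) `x` has an `n`-th root fixed by
`U ∩ σ⁻¹ D_v σ`. THIS FILE is the bridge (P) between the two currencies, which -w5 g7 reported absent from the tree:
* `exists_pow_eq_adicCompletion_of_forall_exists_root_fixed` — if for every `σ ∈ Γ_K` some `n`-th root `β_σ ∈ K̄` of `x ∈ F` is fixed by
  every `τ ∈ Gal(K̄/F)` with `σ τ σ⁻¹ ∈ D_v`, then `x` is an `n`-th power in `F_w` for EVERY place `w ∣ v` of `F`.
Mechanism (no identification `F_w ≅ closure of ι_v(σF)·K_v` is needed): embed `F_w` into `K̄_v = AlgebraicClosure K_v` over `K_v`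
(`ψ`, `IsAlgClosed.lift`; `F_w/K_v` is finite by the vendored FLT base change `CompletionBaseChange`); extend `ψ ∘ (F → F_w)` to
`φ̃ : K̄ → K̄_v` and compare with `ι_v`: `φ̃ = ι_v ∘ σ` for `σ = φ̃.restrictNormal' K̄ ∈ Γ_K`; an element `g ∈ Γ_{K_v}` fixing `ψ(F_w)`
restricts to `r ∈ D_v` with `σ⁻¹ r σ ∈ Gal(K̄/F)`, so it fixes `ι_v(σ β_σ⁻¹…)` — precisely: `τ := σ⁻¹rσ` fixes `β := β_{σ}` (hypothesis at
`σ`), hence `g` fixes `ι_v(σβ)`; by the Galois correspondence in `K̄_v/ψ(F_w)` (`galFixing.exists_algebraMap_eq_of_forall_smul_eq`, char. 0)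
`ι_v(σβ) = ψ(y)` with `y ∈ F_w`, and `ψ(yⁿ) = ι_v(σx) = ψ(x)` gives `yⁿ = x` in `F_w`.
presearch: «completion at a place above v = closure of the embedded field; Kummer class locally trivial iff locally an n-th power» —
Neukirch ANT II (8.2)–(8.3), Cassels–Fröhlich II §10; tree: FLT `adicCompletionSemialgHom` (K_v → F_w), `absGaloisRestrict_apply_smul`,
`KummerGalFixing`; no new fact. beyond-print theorem: no.

References: [NeukirchANT1999] Ch. II (8.2)–(8.3), (9.1); [CasselsFrohlichANT1967] Ch. II §10; [SerreLocalFields1979] X §3 b).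
-/

noncomputable section

set_option linter.dupNamespace false
set_option autoImplicit false

open scoped Classical
open NumberField IsDedekindDomain Field IntermediateField
open Literature.NumberTheory.EllipticCurves Literature.NumberTheory.EllipticCurves.GreenbergSelmer
open Literature.NumberTheory.GaloisRepresentations Literature.NumberTheory.GaloisRepresentations.LocalWeilDatum
open Literature.NumberTheory.AdelicBaseChange

namespace Summit.BirchSwinnertonDyer.BirchSwinnertonDyer.Theorems.PrintCf2.KummerU

variable {K : Type} [Field K] [NumberField K]

/-- **(P) — local `n`-th powers at the places above `v`, from `Γ_K`-internal to completion currency.** Let `F ⊆ K̄` be finite over the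
number field `K`, `v` a finite place of `K`, `x ∈ F`, `n ∈ ℕ`. If for every `σ ∈ Γ_K` there is an `n`-th root `β ∈ K̄` of `x` fixed by every
`τ ∈ Gal(K̄/F)` with `σ τ σ⁻¹ ∈ D_v` (the decomposition group of the tree's chosen place of `K̄` above `v`), then `x` is an `n`-th power in the
completion `F_w` at EVERY place `w` of `F` above `v`. [cite: NeukirchANT1999, Ch. II (8.2)–(8.3)] [cite: SerreLocalFields1979, X §3 b)] -/
theorem exists_pow_eq_adicCompletion_of_forall_exists_root_fixed
    (F : IntermediateField K (AlgebraicClosure K)) [FiniteDimensional K F] [NumberField F]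
    (v : HeightOneSpectrum (𝓞 K)) (n : ℕ) (x : F)
    (hfix : ∀ σ : absoluteGaloisGroup K, ∃ β : AlgebraicClosure K,
      β ^ n = ((x : F) : AlgebraicClosure K) ∧
      ∀ τ : absoluteGaloisGroup K, τ ∈ galFixing K F → σ * τ * σ⁻¹ ∈ decomp v → τ • β = β)
    (w : v.Extension (𝓞 F)) :
    ∃ y : w.1.adicCompletion F, y ^ n = algebraMap F (w.1.adicCompletion F) x := by
  -- notation
  set Kv := v.adicCompletion K with hKv
  set Fw := w.1.adicCompletion F with hFw
  haveI : CharZero Kv := charZero_of_injective_algebraMap (algebraMap K Kv).injective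
  haveI : Algebra.IsAlgebraic Kv Fw := Algebra.IsAlgebraic.of_finite Kv Fw
  -- the square `K → K_v → F_w` / `K → F → F_w` commutes
  have hsq : ∀ k : K, algebraMap Kv Fw (algebraMap K Kv k) = algebraMap F Fw (algebraMap K F k) := fun k ↦
    (w.adicCompletionSemialgHom K F).commutes k
  -- (1) an embedding `ψ : F_w → K̄_v` over `K_v`, and `φ = ψ ∘ (F → F_w) : F → K̄_v` over `K`
  let ψ : Fw →ₐ[Kv] AlgebraicClosure Kv := IsAlgClosed.lift
  let φ : F →ₐ[K] AlgebraicClosure Kv :=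
    { toRingHom := ψ.toRingHom.comp (algebraMap F Fw)
      commutes' := fun k ↦ by
        change ψ (algebraMap F Fw (algebraMap K F k)) = algebraMap K (AlgebraicClosure Kv) k
        rw [← hsq, ψ.commutes, IsScalarTower.algebraMap_apply K Kv (AlgebraicClosure Kv)] }
  have hφ : ∀ f : F, φ f = ψ (algebraMap F Fw f) := fun _ ↦ rfl
  -- (2) extend `φ` to `φ̃ : K̄ → K̄_v` (over `F`, i.e. `φ̃|_F = φ`)
  obtain ⟨φt, hφt⟩ : ∃ φt : AlgebraicClosure K →ₐ[K] AlgebraicClosure Kv,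
      ∀ f : F, φt (f : AlgebraicClosure K) = φ f := by
    letI : Algebra F (AlgebraicClosure Kv) := φ.toRingHom.toAlgebra
    haveI : IsScalarTower K F (AlgebraicClosure Kv) :=
      IsScalarTower.of_algebraMap_eq fun k ↦ (φ.commutes k).symm
    haveI : Algebra.IsAlgebraic F (AlgebraicClosure K) := Algebra.IsAlgebraic.tower_top (K := K) F
    haveI : Module.IsTorsionFree F (AlgebraicClosure Kv) :=
      Module.isTorsionFree_iff_algebraMap_injective.2 φ.toRingHom.injective
    let φt : AlgebraicClosure K →ₐ[F] AlgebraicClosure Kv := IsAlgClosed.lift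
    exact ⟨φt.restrictScalars K, fun f ↦ φt.commutes f⟩
  -- compare with the chosen embedding `ι_v`: `φ̃ = ι_v ∘ σ` for some `σ ∈ Γ_K` (`K̄/K` is normal)
  obtain ⟨σ, hσ⟩ : ∃ σ : absoluteGaloisGroup K, ∀ z : AlgebraicClosure K, absClosureEmbedding K Kv (σ • z) = φt z := by
    letI := absClosureAlgebra K Kv
    haveI := absClosure_isScalarTower K Kv
    let σ₀ : AlgebraicClosure K ≃ₐ[K] AlgebraicClosure K := φt.restrictNormal' (AlgebraicClosure K)
    refine ⟨(absoluteGaloisGroup.toAlgEquiv K).symm σ₀, fun z ↦ ?_⟩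
    rw [absoluteGaloisGroup.toAlgEquiv_symm_apply]
    exact AlgHom.restrictNormal_commutes φt (AlgebraicClosure K) z
  have hinj : Function.Injective (absClosureEmbedding K Kv) := (absClosureEmbedding K Kv).toRingHom.injective
  -- (3) the root `β` at `σ` and the element `z = ι_v(σβ)`
  obtain ⟨β, hβ, hτ⟩ := hfix σ
  set z : AlgebraicClosure Kv := absClosureEmbedding K Kv (σ • β) with hz
  -- every `g ∈ Γ_{K_v}` fixing `ψ(F_w)` fixes `z`
  have hzfix : ∀ g : galFixing Kv ψ.fieldRange, (g : absoluteGaloisGroup Kv) • z = z := by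
    rintro ⟨g, hg⟩
    rw [mem_galFixing_iff] at hg
    set r : absoluteGaloisGroup K := absGaloisRestrict K Kv g with hr
    -- `τ := σ⁻¹ r σ` fixes `F` pointwise
    have hτU : σ⁻¹ * r * σ ∈ galFixing K F := by
      rw [mem_galFixing_iff]
      intro f hf
      have h1 : r • σ • f = σ • f := by
        apply hinj
        rw [hr, absGaloisRestrict_apply_smul, hσ]
        have h2 : φt f = ψ (algebraMap F Fw ⟨f, hf⟩) := by
          rw [← hφ, ← hφt]
        rw [h2]
        exact hg _ (ψ.mem_fieldRange.2 ⟨_, rfl⟩)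
      rw [mul_smul, mul_smul, h1, ← mul_smul, inv_mul_cancel, one_smul]
    have hτD : σ * (σ⁻¹ * r * σ) * σ⁻¹ ∈ decomp v := by
      rw [show σ * (σ⁻¹ * r * σ) * σ⁻¹ = r by group]
      exact (mem_decomp_iff v r).2 ⟨g, rfl⟩
    have h3 : (σ⁻¹ * r * σ) • β = β := hτ _ hτU hτD
    have h4 : r • σ • β = σ • β := by
      have h5 := congrArg (fun t ↦ σ • t) h3
      simp only [mul_smul, smul_inv_smul] at h5
      exact h5
    change g • absClosureEmbedding K Kv (σ • β) = absClosureEmbedding K Kv (σ • β)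
    rw [← absGaloisRestrict_apply_smul, ← hr, h4]
  -- (4) Galois correspondence in `K̄_v / ψ(F_w)`: `z = ψ(y)`
  obtain ⟨b, hb⟩ := galFixing.exists_algebraMap_eq_of_forall_smul_eq (k := Kv) ψ.fieldRange hzfix
  obtain ⟨y, hy⟩ := ψ.mem_fieldRange.1 b.2
  refine ⟨y, ψ.toRingHom.injective ?_⟩
  change ψ (y ^ n) = ψ (algebraMap F Fw x)
  rw [map_pow, hy, show ((b : ψ.fieldRange) : AlgebraicClosure Kv) = z from hb, hz, ← map_pow, ← smul_pow', hβ, hσ, hφt, hφ]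

end Summit.BirchSwinnertonDyer.BirchSwinnertonDyer.Theorems.PrintCf2.KummerU

end
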